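import Literature.Analysis.FluidPDE.PassiveVectorTensorGalerkinIdentity
import HarnessLib

/-!
# Weak passive solenoidal vectors with a constant viscosity tensor: the WEIGHTED (Fourier-multiplier)
# Galerkin energy identity

Analysis/FluidPDE proof-support file (everything proved; no definitions, no named facts).  For the weak class
`Torus.IsWeakTensorPassiveVectorOn A T 𝔸 b w₀ w` (`∂ₜw + (b·∇)w + A (w·∇)b + ∇π = 𝓛_𝔸 w`, `∇·w = 0`,
Frisch (9.57)), `PassiveVectorTensorGalerkinIdentity.ae_sum_sq_norm_mFourierCoeff_eq` sums the one-mode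
energy identities over the frequency BALL `|k| ≤ N` (the sharp truncation `P_N`).  The dyadic-ladder /
commutator method for band localisation (energy above or below a frequency level moved by a smooth
drift) needs the same identity with a SMOOTH Fourier cutoff, i.e. with nonnegative WEIGHTS `ω k`
(typically `ω = χ(k/L)²`) on a finite frequency set `F`:

* `ae_weightedFlux_eq_sum` — the weighted transport flux in Fourier variables: for a.e. `s` and all
  `F, ω`, `∫⟪w(s), (b(s)·∇) Σ_{k∈F} ω_k Re(e_k • ŵ(s)(k))⟫ + A ∫⟪b(s), (w(s)·∇)(…)⟫ = Σ_{k∈F} ω_k Re B_k(s)`;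
* `integrableOn_weightedFlux`, `integrableOn_weightedSymbForm` — integrability of the two weighted integrands;
* **`ae_weighted_sum_sq_norm_mFourierCoeff_eq`** — for `w₀ ∈ L²` weakly divergence free, a.e. `t`, all `F, ω`:
  `Σ_{k∈F} ω_k ‖ŵ(t)(k)‖² + 2∫_{(0,t]} 4π² Σ_{k∈F} ω_k Re⟪ŵ(s)(k), T_𝔸(k)ŵ(s)(k)⟫ ds
     = Σ_{k∈F} ω_k ‖ŵ₀(k)‖² + 2∫_{(0,t]} (weighted flux)(s) ds`
  — the Galerkin system tested against the WEIGHTED truncation of its own solution (Robinson–Rodrigo–Sadowski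
  2016, §4.2 (4.20) with a multiplier in place of `P_N`; Temam 1984, Ch. III Lemma 1.2).
With `ω = χ²` the flux splits as `⟨χw, (b·∇)(χw)⟩ + ⟨w, [(b·∇), χ(D)](χ w)⟩`, the first term vanishing for
a divergence-free carrier and the second controlled by `Literature.Analysis.Fourier.LatticeTransportCommutator`
(strain, not sweeping) — the engine of the band-kill / hop-tail estimates.

Consumer: cell `ad-ideate`, K1L_D `stmt-AnomalousDissipation-27980`, S23‴ sub-stub W3-E (γ) `stub_effectiveFrameEnergyL`
(v23+: floor and band kill for the coarse propagator `Um` along `E.partialSum m`).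

## Mathlib / tree search
Tree: `ae_sq_norm_mFourierCoeff_eq` (one mode, `PassiveVectorTensorModeEnergy`), `sum_mul_integral_inner_convect_eq`,
`integral_inner_convect_realTrigPoly_singleton`, `integrableOn_modeRHS_self`, `integrableOn_inner_symbT`,
`ae_integrable_slice` (`PassiveVectorTensorGalerkinIdentity` / `…Fourier`).  The weighted form did not exist.

## References
* J. C. Robinson, J. L. Rodrigo, W. Sadowski, *The three-dimensional Navier–Stokes equations* (CUP 2016), §4.2 (4.20). [`RobinsonRodrigoSadowski2016`]
* R. Temam, *Navier–Stokes Equations* (North-Holland 1984), Ch. III §1, Lemma 1.2. [`Temam1984`]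
* U. Frisch, *Turbulence* (CUP 1995), §9.6.3 eq. (9.57) p. 233. [`Frisch1995Turbulence`]
-/

noncomputable section

open MeasureTheory Set Filter Function TopologicalSpace Complex UnitAddTorus
open scoped ENNReal NNReal InnerProductSpace ComplexConjugate

namespace Literature.Analysis.FluidPDE

namespace Torus

variable {d : Type*} [Fintype d] [DecidableEq d]

namespace IsWeakTensorPassiveVectorOn

variable {A T : ℝ} {𝔸 : Visc4 d} {b w : ℝ → UnitAddTorus d → EuclideanSpace ℝ d}
  {w₀ : UnitAddTorus d → EuclideanSpace ℝ d}

/-- **The weighted transport flux in Fourier variables**: for a.e. `s ∈ (0,T)`, every finite frequency set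
`F` and all real weights `ω`,
`∫⟪w(s),(b(s)·∇) Σ_{k∈F} ω_k Re(e_k • ŵ(s))⟫ + A∫⟪b(s),(w(s)·∇) Σ_{k∈F} ω_k Re(e_k • ŵ(s))⟫ = Σ_{k∈F} ω_k Re B_k(ŵ(s)(k))(s)`,
`B_k(z)(s) = Σⱼ 2πikⱼ ⟪𝓕(bⱼw)(s)(k), z⟫ + A Σⱼ 2πikⱼ ⟪𝓕(wⱼb)(s)(k), z⟫`. [cite: RobinsonRodrigoSadowski2016, §4.1 (Galerkin truncations)] -/
theorem ae_weightedFlux_eq_sum (h : IsWeakTensorPassiveVectorOn A T 𝔸 b w₀ w) :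
    ∀ᵐ s ∂(volume.restrict (Ioo 0 T)), ∀ (F : Finset (d → ℤ)) (ω : (d → ℤ) → ℝ),
      (∫ x, ⟪w s x, FunctionSpaces.Torus.convect (b s) (fun y => ∑ k ∈ F, ω k •
          FunctionSpaces.Torus.realTrigPoly {k} (fun k' => mFourierCoeff (FunctionSpaces.EuclideanSpace.complexify ∘ w s) k') y) x⟫_ℝ) +
        A * ∫ x, ⟪b s x, FunctionSpaces.Torus.convect (w s) (fun y => ∑ k ∈ F, ω k •
          FunctionSpaces.Torus.realTrigPoly {k} (fun k' => mFourierCoeff (FunctionSpaces.EuclideanSpace.complexify ∘ w s) k') y) x⟫_ℝ =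
      ∑ k ∈ F, ω k *
        ((∑ j, (2 * Real.pi * I * (k j)) *
            ⟪mFourierCoeff (FunctionSpaces.EuclideanSpace.complexify ∘ fun x => b s x j • w s x) k,
              mFourierCoeff (FunctionSpaces.EuclideanSpace.complexify ∘ w s) k⟫_ℂ) +
          (A : ℂ) * ∑ j, (2 * Real.pi * I * (k j)) *
            ⟪mFourierCoeff (FunctionSpaces.EuclideanSpace.complexify ∘ fun x => w s x j • b s x) k,
              mFourierCoeff (FunctionSpaces.EuclideanSpace.complexify ∘ w s) k⟫_ℂ).re := by
  filter_upwards [h.ae_integrable_slice] with s hs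
  intro F ω
  set c : (d → ℤ) → EuclideanSpace ℂ d := fun k' => mFourierCoeff (FunctionSpaces.EuclideanSpace.complexify ∘ w s) k'
    with hc
  have ha : ∀ k : d → ℤ, FunctionSpaces.Torus.IsSmooth (FunctionSpaces.Torus.realTrigPoly {k} c) :=
    fun k => FunctionSpaces.Torus.isSmooth_realTrigPoly _ _
  have e1 : ∫ x, ⟪w s x, FunctionSpaces.Torus.convect (b s) (fun y => ∑ k ∈ F, ω k •
        FunctionSpaces.Torus.realTrigPoly {k} c y) x⟫_ℝ =
      ∑ k ∈ F, ω k * (∑ j, (2 * Real.pi * I * (k j)) *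
        ⟪mFourierCoeff (FunctionSpaces.EuclideanSpace.complexify ∘ fun x => b s x j • w s x) k, c k⟫_ℂ).re := by
    rw [← sum_mul_integral_inner_convect_eq F ω ha hs.2.1]
    refine Finset.sum_congr rfl fun k _ => ?_
    rw [integral_inner_convect_realTrigPoly_singleton hs.2.1 k c]
  have e2 : ∫ x, ⟪b s x, FunctionSpaces.Torus.convect (w s) (fun y => ∑ k ∈ F, ω k •
        FunctionSpaces.Torus.realTrigPoly {k} c y) x⟫_ℝ =
      ∑ k ∈ F, ω k * (∑ j, (2 * Real.pi * I * (k j)) *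
        ⟪mFourierCoeff (FunctionSpaces.EuclideanSpace.complexify ∘ fun x => w s x j • b s x) k, c k⟫_ℂ).re := by
    rw [← sum_mul_integral_inner_convect_eq F ω ha hs.2.2]
    refine Finset.sum_congr rfl fun k _ => ?_
    rw [integral_inner_convect_realTrigPoly_singleton hs.2.2 k c]
  rw [e1, e2, Finset.mul_sum, ← Finset.sum_add_distrib]
  refine Finset.sum_congr rfl fun k _ => ?_
  rw [Complex.add_re, Complex.re_ofReal_mul]
  ring

/-- The weighted transport flux is integrable on `(0,T)`. [cite: RobinsonRodrigoSadowski2016, §4.2 (Galerkin energy estimate)] -/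
theorem integrableOn_weightedFlux (h : IsWeakTensorPassiveVectorOn A T 𝔸 b w₀ w) (F : Finset (d → ℤ)) (ω : (d → ℤ) → ℝ) :
    IntegrableOn (fun s =>
      (∫ x, ⟪w s x, FunctionSpaces.Torus.convect (b s) (fun y => ∑ k ∈ F, ω k •
          FunctionSpaces.Torus.realTrigPoly {k} (fun k' => mFourierCoeff (FunctionSpaces.EuclideanSpace.complexify ∘ w s) k') y) x⟫_ℝ) +
        A * ∫ x, ⟪b s x, FunctionSpaces.Torus.convect (w s) (fun y => ∑ k ∈ F, ω k •
          FunctionSpaces.Torus.realTrigPoly {k} (fun k' => mFourierCoeff (FunctionSpaces.EuclideanSpace.complexify ∘ w s) k') y) x⟫_ℝ)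
      (Ioo 0 T) volume := by
  have hsum : IntegrableOn (fun s => ∑ k ∈ F, ω k *
      ((∑ j, (2 * Real.pi * I * (k j)) *
          ⟪mFourierCoeff (FunctionSpaces.EuclideanSpace.complexify ∘ fun x => b s x j • w s x) k,
            mFourierCoeff (FunctionSpaces.EuclideanSpace.complexify ∘ w s) k⟫_ℂ) +
        (A : ℂ) * ∑ j, (2 * Real.pi * I * (k j)) *
          ⟪mFourierCoeff (FunctionSpaces.EuclideanSpace.complexify ∘ fun x => w s x j • b s x) k,
            mFourierCoeff (FunctionSpaces.EuclideanSpace.complexify ∘ w s) k⟫_ℂ).re) (Ioo 0 T) volume :=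
    integrable_finsetSum _ fun k _ => (h.integrableOn_modeRHS_self k).re.const_mul _
  refine hsum.congr ?_
  filter_upwards [h.ae_weightedFlux_eq_sum] with s hs
  exact (hs F ω).symm

/-- The weighted symbol form `s ↦ 4π² Σ_{k∈F} ω_k Re⟪ŵ(s)(k), T_𝔸(k) ŵ(s)(k)⟫` is integrable on `(0,T)`.
[cite: Frisch1995Turbulence, §9.6.3 eq. (9.57) p. 233] -/
theorem integrableOn_weightedSymbForm (h : IsWeakTensorPassiveVectorOn A T 𝔸 b w₀ w) (F : Finset (d → ℤ)) (ω : (d → ℤ) → ℝ) :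
    IntegrableOn (fun s => 4 * Real.pi ^ 2 * ∑ k ∈ F, ω k *
      (⟪mFourierCoeff (FunctionSpaces.EuclideanSpace.complexify ∘ w s) k,
        symbT 𝔸 k (mFourierCoeff (FunctionSpaces.EuclideanSpace.complexify ∘ w s) k)⟫_ℂ).re) (Ioo 0 T) volume :=
  (integrable_finsetSum _ fun k _ => (h.integrableOn_inner_symbT k).re.const_mul _).const_mul _

/-- **The WEIGHTED Galerkin energy identity of a weak tensor-viscosity passive-vector solution (Fourier form).**
For a datum `w₀ ∈ L²` weakly divergence free, a.e. `t ∈ (0,T)`, every finite frequency set `F` and all real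
weights `ω`:
`Σ_{k∈F} ω_k ‖ŵ(t)(k)‖² + 2 ∫_{(0,t]} 4π² Σ_{k∈F} ω_k Re⟪ŵ(s)(k), T_𝔸(k)ŵ(s)(k)⟫ ds
   = Σ_{k∈F} ω_k ‖ŵ₀(k)‖² + 2 ∫_{(0,t]} WFlux_{F,ω}(s) ds`,
`WFlux_{F,ω}(s) = ∫⟪w(s),(b(s)·∇) Σ_k ω_k Re(e_k • ŵ(s)(k))⟫ + A ∫⟪b(s),(w(s)·∇) Σ_k ω_k Re(e_k • ŵ(s)(k))⟫`
— the one-mode identities weighted and summed (the sharp-ball case `ω = 1_{|k|≤N}` is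
`ae_sum_sq_norm_mFourierCoeff_eq`). [cite: RobinsonRodrigoSadowski2016, §4.2 (4.20)] [cite: Temam1984, Ch. III §1.1] -/
theorem ae_weighted_sum_sq_norm_mFourierCoeff_eq (h : IsWeakTensorPassiveVectorOn A T 𝔸 b w₀ w) (hw₀ : MemLp w₀ 2 volume)
    (hdiv₀ : FunctionSpaces.Torus.IsWeaklyDivFree w₀) :
    ∀ᵐ t ∂(volume.restrict (Ioo 0 T)), ∀ (F : Finset (d → ℤ)) (ω : (d → ℤ) → ℝ),
      (∑ k ∈ F, ω k * ‖mFourierCoeff (FunctionSpaces.EuclideanSpace.complexify ∘ w t) k‖ ^ 2) +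
          2 * ∫ s in Ioc 0 t, 4 * Real.pi ^ 2 * ∑ k ∈ F, ω k *
            (⟪mFourierCoeff (FunctionSpaces.EuclideanSpace.complexify ∘ w s) k,
              symbT 𝔸 k (mFourierCoeff (FunctionSpaces.EuclideanSpace.complexify ∘ w s) k)⟫_ℂ).re =
        (∑ k ∈ F, ω k * ‖mFourierCoeff (FunctionSpaces.EuclideanSpace.complexify ∘ w₀) k‖ ^ 2) +
          2 * ∫ s in Ioc 0 t,
            ((∫ x, ⟪w s x, FunctionSpaces.Torus.convect (b s) (fun y => ∑ k ∈ F, ω k •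
                FunctionSpaces.Torus.realTrigPoly {k} (fun k' => mFourierCoeff (FunctionSpaces.EuclideanSpace.complexify ∘ w s) k') y) x⟫_ℝ) +
              A * ∫ x, ⟪b s x, FunctionSpaces.Torus.convect (w s) (fun y => ∑ k ∈ F, ω k •
                FunctionSpaces.Torus.realTrigPoly {k} (fun k' => mFourierCoeff (FunctionSpaces.EuclideanSpace.complexify ∘ w s) k') y) x⟫_ℝ) := by
  -- names
  set X : (d → ℤ) → ℝ → EuclideanSpace ℂ d := fun k t =>
    mFourierCoeff (FunctionSpaces.EuclideanSpace.complexify ∘ w t) k with hX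
  set X₀ : (d → ℤ) → EuclideanSpace ℂ d := fun k =>
    mFourierCoeff (FunctionSpaces.EuclideanSpace.complexify ∘ w₀) k with hX₀
  set Bf : (d → ℤ) → ℝ → ℂ := fun k s =>
    (∑ j, (2 * Real.pi * I * (k j)) *
        ⟪mFourierCoeff (FunctionSpaces.EuclideanSpace.complexify ∘ fun x => b s x j • w s x) k, X k s⟫_ℂ) +
      (A : ℂ) * ∑ j, (2 * Real.pi * I * (k j)) *
        ⟪mFourierCoeff (FunctionSpaces.EuclideanSpace.complexify ∘ fun x => w s x j • b s x) k, X k s⟫_ℂ with hBf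
  set Vf : (d → ℤ) → ℝ → ℂ := fun k s => ⟪X k s, symbT 𝔸 k (X k s)⟫_ℂ with hVf
  have hHi : ∀ k, IntegrableOn (fun s => ((-(4 * Real.pi ^ 2 : ℝ) : ℂ) * Vf k s + Bf k s).re) (Ioo 0 T) volume :=
    fun k => (((h.integrableOn_inner_symbT k).const_mul _).add (h.integrableOn_modeRHS_self k)).re
  -- all one-mode identities at once, and the weighted flux identification
  have hmodes := ae_all_iff.2 fun k => h.ae_sq_norm_mFourierCoeff_eq hw₀ hdiv₀ k
  have hflux' : ∀ᵐ s ∂(volume : Measure ℝ), s ∈ Ioo 0 T → ∀ (F : Finset (d → ℤ)) (ω : (d → ℤ) → ℝ),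
      (∫ x, ⟪w s x, FunctionSpaces.Torus.convect (b s) (fun y => ∑ k ∈ F, ω k •
          FunctionSpaces.Torus.realTrigPoly {k} (fun k' => mFourierCoeff (FunctionSpaces.EuclideanSpace.complexify ∘ w s) k') y) x⟫_ℝ) +
        A * ∫ x, ⟪b s x, FunctionSpaces.Torus.convect (w s) (fun y => ∑ k ∈ F, ω k •
          FunctionSpaces.Torus.realTrigPoly {k} (fun k' => mFourierCoeff (FunctionSpaces.EuclideanSpace.complexify ∘ w s) k') y) x⟫_ℝ =
      ∑ k ∈ F, ω k * (Bf k s).re :=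
    (ae_restrict_iff' measurableSet_Ioo).1 h.ae_weightedFlux_eq_sum
  filter_upwards [hmodes, ae_restrict_mem measurableSet_Ioo] with t ht htT
  intro F ω
  have hsub : Ioc 0 t ⊆ Ioo 0 T := Ioc_subset_Ioo_right htT.2
  -- weight and sum the one-mode identities
  have hsum : ∑ k ∈ F, ω k * ‖X k t‖ ^ 2 =
      ∑ k ∈ F, (ω k * ‖X₀ k‖ ^ 2 +
        2 * ∫ s in Ioc 0 t, ω k * ((-(4 * Real.pi ^ 2 : ℝ) : ℂ) * Vf k s + Bf k s).re) := by
    refine Finset.sum_congr rfl fun k _ => ?_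
    rw [ht k, mul_add, integral_const_mul]
    ring
  have hHiω : ∀ k, IntegrableOn (fun s => ω k * ((-(4 * Real.pi ^ 2 : ℝ) : ℂ) * Vf k s + Bf k s).re) (Ioo 0 T) volume :=
    fun k => (hHi k).const_mul (ω k)
  rw [Finset.sum_add_distrib, ← Finset.mul_sum,
    ← integral_finsetSum _ (fun k _ => (hHiω k).mono_set hsub)] at hsum
  -- split the summed integrand
  have hsplit : ∫ s in Ioc 0 t, ∑ k ∈ F, ω k * ((-(4 * Real.pi ^ 2 : ℝ) : ℂ) * Vf k s + Bf k s).re =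
      (∫ s in Ioc 0 t, ∑ k ∈ F, ω k * (Bf k s).re) -
        ∫ s in Ioc 0 t, 4 * Real.pi ^ 2 * ∑ k ∈ F, ω k * (Vf k s).re := by
    have hQi : IntegrableOn (fun s => 4 * Real.pi ^ 2 * ∑ k ∈ F, ω k * (Vf k s).re) (Ioc 0 t) volume :=
      (h.integrableOn_weightedSymbForm F ω).mono_set hsub
    have hFli' : IntegrableOn (fun s => ∑ k ∈ F, ω k * (Bf k s).re) (Ioo 0 T) volume :=
      integrable_finsetSum _ fun k _ => (h.integrableOn_modeRHS_self k).re.const_mul _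
    have hFli : IntegrableOn (fun s => ∑ k ∈ F, ω k * (Bf k s).re) (Ioc 0 t) volume := hFli'.mono_set hsub
    rw [← integral_sub hFli hQi]
    refine setIntegral_congr_fun measurableSet_Ioc fun s _ => ?_
    rw [Finset.mul_sum, ← Finset.sum_sub_distrib]
    refine Finset.sum_congr rfl fun k _ => ?_
    rw [Complex.add_re, neg_mul, Complex.neg_re, Complex.re_ofReal_mul]
    ring
  have hflux_t : ∫ s in Ioc 0 t, ∑ k ∈ F, ω k * (Bf k s).re =
      ∫ s in Ioc 0 t, ((∫ x, ⟪w s x, FunctionSpaces.Torus.convect (b s) (fun y => ∑ k ∈ F, ω k •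
          FunctionSpaces.Torus.realTrigPoly {k} (fun k' => mFourierCoeff (FunctionSpaces.EuclideanSpace.complexify ∘ w s) k') y) x⟫_ℝ) +
        A * ∫ x, ⟪b s x, FunctionSpaces.Torus.convect (w s) (fun y => ∑ k ∈ F, ω k •
          FunctionSpaces.Torus.realTrigPoly {k} (fun k' => mFourierCoeff (FunctionSpaces.EuclideanSpace.complexify ∘ w s) k') y) x⟫_ℝ) := by
    refine setIntegral_congr_ae measurableSet_Ioc ?_
    filter_upwards [hflux'] with s hs hsI
    exact (hs (hsub hsI) F ω).symm
  rw [hsplit, hflux_t] at hsum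
  rw [hX] at hsum
  simp only at hsum
  linarith

end IsWeakTensorPassiveVectorOn

end Torus

end Literature.Analysis.FluidPDE

end
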